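import Mathlib
import Summits.ValiantsHypothesis.Statement
import Summits.ValiantsHypothesis.ValiantsHypothesis.Theorems.LacunarySymmetroidTowerDoor

/-!
# The tower graft law S5 as a NAMED TARGET STATEMENT, and the door it opens

Companion to `Theorems/LacunarySymmetroidTowerDoor.lean` (p672005, `valiant_of_towerB_alone : TowerB → VP ≠ VNP`).
This file NAMES the one research statement the tower door consumes — **S5, the tower graft law** `TowerGraftLaw`
(= `Cruxes/WeakLifting/Lines/tower_graft.lean :: TowerGraftLine.TowerGraftLaw`, rev 11, definitionally; stub
`stub_oneLetterGraftLaw`) — as a `def … : Prop` (a TARGET statement typed as a named `Prop`, never asserted here; NOT a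
published result; OPEN), and proves the two joints over Theorems-level declarations only:
`towerB_of_towerGraftLaw` — (GL) iterated along the tower is TOWER-B (induction on `K`, constant `C + 1`; port of
`TowerGraftLine.towerB_of_graftLaw`), and `valiant_of_towerGraftLaw : TowerGraftLaw → VP ≠ VNP`.
Purpose (director-valiant g17 R313 (1), coordinator 21-frontier b141 «YES, keep ONE: TowerDoorS5»): the door route
`Theses/TowerDoorS5.lean` is a CONDITIONAL BRIDGE on this named statement — DOOR · single open research statement S5 ·
sufficient not equivalent · NOT a decomposition · contributes 0 to summit-progress accounting until S5 moves.
VP ≠ VNP is NOT proved: `TowerGraftLaw` is open. [target statement of the cell pub-symmetroid; no citation exists]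
-/

-- `Summit.ValiantsHypothesis.ValiantsHypothesis.…` repeats a component by the D-0017 layout
-- (single-conjunct summit), which the `dupNamespace` linter flags; the name is mandated.
set_option linter.dupNamespace false

namespace Summit.ValiantsHypothesis.ValiantsHypothesis.Theorems.TowerDoorS5

/-- **S5 — THE TOWER GRAFT LAW (GL)** (target statement, OPEN; nothing asserted).  On an `m`-tower support `d`
(every exponent exceeds `m` times every earlier one), grafting ONE far letter `X ^ D` (`D > m · max d`) onto a real
symmetric lacunary pencil costs at most a constant FACTOR plus a QUASI-POLYNOMIAL additive term in the number of distinct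
positive real zeros of the determinant: `PosRootLawOn m K B d → PosRootLawOn m (K+1) (2^C·B + 2^{C ⌊log₂ m⌋²}) (d ⊔ D)`.
Definitionally equal to `Cruxes/WeakLifting/Lines/tower_graft.lean :: TowerGraftLine.TowerGraftLaw` (tower predicate
spelled out). [target statement of the cell; no citation exists] -/
def TowerGraftLaw : Prop :=
  ∃ C : ℕ, ∀ (m K B D : ℕ) (d : Fin K → ℕ), (∀ l l' : Fin K, l < l' → m * d l < d l') → (∀ l, m * d l < D) →
    Summit.ValiantsHypothesis.ValiantsHypothesis.Theorems.LacunarySymmetroidMatrixDescartes.PosRootLawOn m K B d →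
    Summit.ValiantsHypothesis.ValiantsHypothesis.Theorems.LacunarySymmetroidMatrixDescartes.PosRootLawOn m (K + 1)
      (2 ^ C * B + 2 ^ (C * Nat.log 2 m ^ 2)) (Fin.snoc d D)

/-- **(GL) iterated along the tower = TOWER-B** (the hypothesis of `LacunarySymmetroid.TowerDoor.valiant_of_towerB_alone`,
verbatim; induction on `K`, `B_{K+1} = 2^C B_K + 2^{C L²}`, constant `C + 1`). [folklore] -/
theorem towerB_of_towerGraftLaw (h : TowerGraftLaw) :
    ∃ C : ℕ, ∀ (m K : ℕ) (d : Fin K → ℕ), (∀ l l' : Fin K, l < l' → m * d l < d l') →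
      Summit.ValiantsHypothesis.ValiantsHypothesis.Theorems.LacunarySymmetroidMatrixDescartes.PosRootLawOn m K
        (2 ^ (C * (K + Nat.log 2 m ^ 2))) d := by
  revert h
  rintro ⟨C, hC⟩
  refine ⟨C + 1, ?_⟩
  have garith : ∀ C K L : ℕ,
      2 ^ C * 2 ^ ((C + 1) * (K + L ^ 2)) + 2 ^ (C * L ^ 2) ≤ 2 ^ ((C + 1) * (K + 1 + L ^ 2)) := by
    intro C K L
    have hA : C * L ^ 2 ≤ (C + 1) * (K + L ^ 2) := by nlinarith [Nat.zero_le (L ^ 2), Nat.zero_le K, Nat.zero_le C]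
    have h1 : 2 ^ (C * L ^ 2) ≤ 2 ^ ((C + 1) * (K + L ^ 2)) := Nat.pow_le_pow_right two_pos hA
    have h2 : 2 ^ ((C + 1) * (K + L ^ 2)) ≤ 2 ^ C * 2 ^ ((C + 1) * (K + L ^ 2)) :=
      Nat.le_mul_of_pos_left _ (Nat.two_pow_pos C)
    have h3 : 2 ^ ((C + 1) * (K + 1 + L ^ 2)) = 2 * (2 ^ C * 2 ^ ((C + 1) * (K + L ^ 2))) := by
      have : (C + 1) * (K + 1 + L ^ 2) = ((C + 1) * (K + L ^ 2) + C) + 1 := by ring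
      rw [this, pow_succ, pow_add]; ring
    rw [h3]
    omega
  intro m K
  induction K with
  | zero =>
    intro d _ S hS
    have h0 : (∑ l : Fin 0, (Polynomial.X : Polynomial ℝ) ^ d l • (S l).map Polynomial.C) = 0 := by simp
    rw [h0]
    rcases Nat.eq_zero_or_pos m with hm | hm
    · subst hm
      simp [Matrix.det_isEmpty]
    · haveI : Nonempty (Fin m) := ⟨⟨0, hm⟩⟩
      simp [Matrix.det_zero]
  | succ K ih =>
    intro d hd
    have hinit : ∀ l l' : Fin K, l < l' → m * Fin.init d l < Fin.init d l' :=
      fun l l' hll' => hd l.castSucc l'.castSucc (Fin.castSucc_lt_castSucc_iff.mpr hll')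
    have hlast : ∀ l : Fin K, m * Fin.init d l < d (Fin.last K) :=
      fun l => hd l.castSucc (Fin.last K) (Fin.castSucc_lt_last l)
    have h₁ := ih (Fin.init d) hinit
    have h₂ := hC m K _ (d (Fin.last K)) (Fin.init d) hinit hlast h₁
    rw [Fin.snoc_init_self] at h₂
    exact fun S hS => (h₂ S hS).trans (garith C K (Nat.log 2 m))

/-- **THE DOOR: `TowerGraftLaw → VP ≠ VNP`** (S5 alone suffices; PencilTransfer and the tower ThetaWitness are theorems,
p672005).  VP ≠ VNP is NOT proved: `TowerGraftLaw` is OPEN. [folklore] -/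
theorem valiant_of_towerGraftLaw (h : TowerGraftLaw) : _root_.ValiantsHypothesis :=
  Summit.ValiantsHypothesis.ValiantsHypothesis.Theorems.LacunarySymmetroid.TowerDoor.valiant_of_towerB_alone
    (towerB_of_towerGraftLaw h)

end Summit.ValiantsHypothesis.ValiantsHypothesis.Theorems.TowerDoorS5
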